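import Summits.NavierStokesRegularity.NavierStokesRegularity.Theorems.ScalingDefectPeepholeDoorAnnularPressure
import Summits.NavierStokesRegularity.NavierStokesRegularity.Theorems.ScalingDefectPeepholeDoorRigidity
import Summits.NavierStokesRegularity.NavierStokesRegularity.Theorems.ScalingDefectPeepholeDoorCriterion
import Summits.NavierStokesRegularity.NavierStokesRegularity.Theorems.ScalingDefectPeepholeDoorTubePropagation

/-!
# ScalingDefectPeepholeDoorDoor — door S30 «ScalingDefectPeepholeDoor» v2: the DOOR MODULO K1ω (ns-s29-p2 g2)

Composition of the landed plates of `ScalingDefectPeepholeDoorDefs` (P0, `targetVortexDefectPeephole_of`):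
P1 `tubePropagation_holds` (h₂), P3 `quietVortexCoreRigidity_holds` (hC), P3b `regularOfQuietCoreVorticity_holds` (hR),
P4 `frameTransferS30_holds` (hF).  What remains is exactly plate P2 = K1ω `VortexDefectTubeBound` (h₁):

* `vortexDefectPeepholeToCore_of_tubeBound : VortexDefectTubeBound → VortexDefectPeepholeToCore`,
* `pvVortexDefectPeepholeRegularity_of_tubeBound : VortexDefectTubeBound → PVVortexDefectPeepholeRegularity`,
* `targetVortexDefectPeephole_of_tubeBound : VortexDefectTubeBound → TargetVortexDefectPeephole` — the K1ω prover closes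
  the door S30 by `targetVortexDefectPeephole_of_tubeBound vortexDefectTubeBound_holds`.

Door S30 is a regularity CRITERION inside a HYPOTHETICAL local Type-I blow-up (item 0056 `NoTypeII` stays OPEN); nothing here
bears on NS regularity itself.
-/

noncomputable section

set_option linter.dupNamespace false

namespace Summit.NavierStokesRegularity.NavierStokesRegularity.Theorems.ScalingDefectPeepholeDoor

/-- P1 + K1ω ⇒ the vortex-defect peephole-to-core transfer. -/
theorem vortexDefectPeepholeToCore_of_tubeBound (h₁ : VortexDefectTubeBound) : VortexDefectPeepholeToCore :=
  vortexDefectPeepholeToCore_of h₁ tubePropagation_holds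

/-- P1 + P3 + P3b + K1ω ⇒ regularity in the Pineau–Vicol frame. -/
theorem pvVortexDefectPeepholeRegularity_of_tubeBound (h₁ : VortexDefectTubeBound) : PVVortexDefectPeepholeRegularity :=
  pvVortexDefectPeepholeRegularity_of (vortexDefectPeepholeToCore_of_tubeBound h₁) quietVortexCoreRigidity_holds
    regularOfQuietCoreVorticity_holds

/-- **DOOR S30 MODULO K1ω**: `VortexDefectTubeBound → TargetVortexDefectPeephole` (plates P1, P3, P3b, P4 discharged by name). -/
theorem targetVortexDefectPeephole_of_tubeBound (h₁ : VortexDefectTubeBound) : TargetVortexDefectPeephole :=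
  targetVortexDefectPeephole_of h₁ tubePropagation_holds quietVortexCoreRigidity_holds regularOfQuietCoreVorticity_holds
    frameTransferS30_holds

end Summit.NavierStokesRegularity.NavierStokesRegularity.Theorems.ScalingDefectPeepholeDoor

end
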